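import Literature.NumberTheory.PAdicHodge.AinfThetaFrobeniusVanishing
import Literature.NumberTheory.PAdicHodge.TiltUntiltDivisibility
import Literature.NumberTheory.PAdicHodge.BdRPlusLatticeComplete
import HarnessLib

/-!
# Fontaine's `𝔸_inf`-lemma: `{a ∈ 𝔸_inf : θ(φᵏ a) = 0 for all k ≥ 0} = ([ε] − 1)·𝔸_inf`

Topic `Literature/NumberTheory/PAdicHodge`; namespace `Literature.NumberTheory.PAdicHodge`. THEOREMS ONLY (no definition, no named
fact, no instance, no `sorry`). For `𝔸_inf(F) = 𝕎(𝒪_{ℂ_F}♭)` with Fontaine's `θ`, the Witt-vector Frobenius `φ` (inverse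
`σ = (frobeniusEquiv p _).symm`) and `u = [ε] − 1`:

* `norm_untilt_eps_sub_one_pow` — **`‖(ε − 1)♯‖^{p−1} = ‖p‖^p`** in `ℂ_F` (i.e. `v(ε − 1) = p/(p−1)`), from the coefficient
  `ζ_{p²} − 1` of `ε − 1` and `‖ζ_{p²} − 1‖^{p(p−1)} = ‖p‖`;
* `norm_untilt_prod_symm_iterate_pFlat_pow` — `‖(∏_{j≤n} σʲ p♭)♯‖^{pⁿ(p−1)} = ‖p‖^{p^{n+1} − 1}`
  (`v(∏_{j≤n} (p♭)^{1/pʲ}) = 1 + 1/p + ⋯ + 1/pⁿ`);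
* ★ `norm_untilt_constantCoeff_le_of_forall_fontaineTheta_frobenius_iterate_eq_zero` — if `θ(φᵏ a) = 0` for all `k` then
  **`‖ā♯‖ ≤ ‖(ε − 1)♯‖`** (`ā = a mod p`): `ā` is divisible by every `∏_{j≤n} (p♭)^{1/pʲ}`
  (`AinfThetaFrobeniusVanishing`), whose valuations `1 + 1/p + ⋯ + 1/pⁿ` increase to `p/(p−1) = v(ε − 1)`;
* `uAinf_mul_mem_span_pow_iff` — `u` is a non-zero-divisor modulo every `pᴺ`;
* ★★ `uAinf_dvd_iff_forall_fontaineTheta_frobenius_iterate_eq_zero` — **`([ε] − 1) ∣ a ↔ θ(φᵏ a) = 0` for all `k ≥ 0`**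
  (Fontaine's `I^{[1]}𝔸_inf = ([ε] − 1)𝔸_inf`): by the norm estimate and the valuation ring `𝒪_{ℂ_F}♭`, `ā ∈ (ε − 1)𝒪♭`, so
  `a = u·c₀ + p·a₁` with `a₁` again in the ideal (`θ(φᵏ u) = 0`, `𝒪_{ℂ_F}` is `p`-torsion free); iterating, `a ∈ u𝔸_inf + pᴺ𝔸_inf`
  for every `N`, and `u𝔸_inf` is `p`-adically closed (`u` regular mod `pᴺ`, `𝔸_inf` `p`-adically complete and separated).

This is the `𝔸_inf`-half of Colmez's `t`-divisibility criterion (TDIV) behind brick B7 (Fontaine's lemma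
`(A_max)^{φ=p} ∩ ker θ ⊆ ℚ_p·t`) of the φ-road of line `kato_lever` (crux K★ `stmt-BirchSwinnertonDyer-22226`, memos
`Cruxes/StarredOptimalManinUnitFiveSeven/Lines/kato-lever-K2-phi-road.md`, `…/kato-lever-K2-fontaine-lemma.md` §1).
Infrastructure only: BSD / K★ are not proved by any of this.

## References
* [FontaineAsterisque223III] J.-M. Fontaine, *Le corps des périodes p-adiques*, Astérisque 223 (1994), Exp. II §1.2.2, Exp. III
  Prop. 5.1.2–5.1.3 (`I^{[1]}W(R) = ([ε]−1)W(R)`).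
* [FontaineOuyang2022] J.-M. Fontaine, Y. Ouyang, *Theory of p-adic Galois representations*, Prop. 4.3.3, Prop. 6.2.? (`I^{[r]}`).
-/

noncomputable section

open WittVector Field ValuativeRel Finset

namespace Literature.NumberTheory.PAdicHodge

open Literature.NumberTheory.GaloisRepresentations
open Literature.NumberTheory.GaloisRepresentations.IsNonarchimedeanLocalField

variable {F : Type} [Field F] [ValuativeRel F] [TopologicalSpace F] [IsNonarchimedeanLocalField F]
  [CharZero F] {p : ℕ} [Fact p.Prime] [Fact (¬ IsUnit (p : integerC F))]
  [IsAdicComplete (Ideal.span {(p : integerC F)}) (integerC F)]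

/-! ### §1 Norms in the tilt: `‖(ε − 1)♯‖^{p−1} = ‖p‖^p` and `‖(∏_{j≤n} σʲp♭)♯‖^{pⁿ(p−1)} = ‖p‖^{p^{n+1}−1}` -/

omit [CharZero F] in
/-- If the `n`-th coefficient of `y ∈ 𝒪_{ℂ_F}♭` is `c mod p` with `‖c‖ > ‖p‖`, then `‖(σⁿ y)♯‖ = ‖c‖` (`(σⁿy)♯ ≡ c (mod p)` and the
ultrametric inequality). [cite: FontaineAsterisque223III, Exp. II §1.2.2] -/
theorem norm_untilt_frobeniusEquiv_symm_iterate_eq_of_coeff_eq {y : PreTilt (integerC F) p} {n : ℕ} {c : integerC F}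
    (hc : PreTilt.coeff n y = Ideal.Quotient.mk (Ideal.span {(p : integerC F)}) c)
    (hlt : ‖(p : CompletedAlgClosure F)‖ < ‖(c : CompletedAlgClosure F)‖) :
    ‖((PreTilt.untilt (((frobeniusEquiv (PreTilt (integerC F) p) p).symm^[n]) y) : integerC F) : CompletedAlgClosure F)‖ =
      ‖(c : CompletedAlgClosure F)‖ := by
  have h1 := mk_untilt_frobeniusEquiv_symm y n
  rw [hc, Ideal.Quotient.eq, Ideal.mem_span_singleton] at h1
  obtain ⟨d, hd⟩ := h1
  set x : CompletedAlgClosure F :=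
    ((PreTilt.untilt (((frobeniusEquiv (PreTilt (integerC F) p) p).symm^[n]) y) : integerC F) : CompletedAlgClosure F) with hx
  have hd' : x - (c : CompletedAlgClosure F) = (p : CompletedAlgClosure F) * ((d : integerC F) : CompletedAlgClosure F) := by
    have h2 := congrArg (fun z : integerC F => (z : CompletedAlgClosure F)) hd
    simp only [AddSubgroupClass.coe_sub, Subring.coe_mul, coe_natCast_integerC] at h2
    rw [hx]; exact h2
  have hsmall : ‖x - (c : CompletedAlgClosure F)‖ < ‖(c : CompletedAlgClosure F)‖ := by
    rw [hd', norm_mul]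
    exact lt_of_le_of_lt (mul_le_of_le_one_right (norm_nonneg _) (norm_coe_integerC_le d)) hlt
  -- `x = (x - c) + c`, ultrametric with `‖x - c‖ < ‖c‖`
  have e : x = (x - (c : CompletedAlgClosure F)) + (c : CompletedAlgClosure F) := by ring
  rw [e]
  exact IsUltrametricDist.norm_add_eq_max_of_norm_ne_norm (ne_of_lt hsmall) |>.trans (max_eq_right hsmall.le)

omit [IsAdicComplete (Ideal.span {(p : integerC F)}) (integerC F)] in
/-- `‖ζ_{p²} − 1‖ > ‖p‖` in `ℂ_F` (`‖ζ_{p²} − 1‖^{p(p−1)} = ‖p‖ < 1` and `p(p−1) ≥ 2`). [cite: FontaineOuyang2022, §3.1] -/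
theorem norm_natCast_lt_norm_epsC_two_sub_one :
    ‖(p : CompletedAlgClosure F)‖ < ‖((epsC p 2 : integerC F) : CompletedAlgClosure F) - 1‖ := by
  have hp := (Fact.out : p.Prime)
  have h2 := norm_epsC_sub_one_pow (F := F) (p := p) (m := 2) (by norm_num)
  rw [Nat.totient_prime_pow hp (by norm_num : 0 < 2), show 2 - 1 = 1 from rfl, pow_one] at h2
  have hlt : ‖(p : CompletedAlgClosure F)‖ < 1 := norm_natCast_C_lt_one'
  have hp0 : 0 < ‖(p : CompletedAlgClosure F)‖ := norm_pos_iff.2 (natCast_C_ne_zero hp.ne_zero)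
  have hk : 2 ≤ p * (p - 1) := by
    calc 2 = 2 * 1 := by norm_num
      _ ≤ p * (p - 1) := Nat.mul_le_mul hp.two_le (by have := hp.two_le; omega)
  by_contra h
  rw [not_lt] at h
  have h3 : ‖(p : CompletedAlgClosure F)‖ ≤ ‖(p : CompletedAlgClosure F)‖ ^ (p * (p - 1)) := by
    conv_lhs => rw [← h2]
    exact pow_le_pow_left₀ (norm_nonneg _) h _
  have h4 : ‖(p : CompletedAlgClosure F)‖ ^ (p * (p - 1)) < ‖(p : CompletedAlgClosure F)‖ ^ 1 :=
    pow_lt_pow_right_of_lt_one₀ hp0 hlt (by omega)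
  rw [pow_one] at h4
  exact absurd (h3.trans_lt h4) (lt_irrefl _)

/-- **`‖(ε − 1)♯‖^{p−1} = ‖p‖^p`** in `ℂ_F`, i.e. `v(ε − 1) = p/(p−1)·v(p)`: the second coefficient of `ε − 1` is `ζ_{p²} − 1`, of norm
`> ‖p‖`, so `‖(ε−1)♯‖ = ‖ζ_{p²} − 1‖^{p²}` and `‖ζ_{p²} − 1‖^{p(p−1)} = ‖p‖`. [cite: FontaineAsterisque223III, Exp. II §1.5.4]
[cite: FontaineOuyang2022, §4.3] -/
theorem norm_untilt_eps_sub_one_pow :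
    ‖((PreTilt.untilt ((eps : PreTilt (integerC F) p) - 1) : integerC F) : CompletedAlgClosure F)‖ ^ (p - 1) =
      ‖(p : CompletedAlgClosure F)‖ ^ p := by
  have hp := (Fact.out : p.Prime)
  have hc : PreTilt.coeff 2 ((eps : PreTilt (integerC F) p) - 1) =
      Ideal.Quotient.mk (Ideal.span {(p : integerC F)}) (epsC p 2 - 1) := by
    rw [map_sub, map_one, coeff_eps, map_sub, map_one]
  have h1 := norm_untilt_frobeniusEquiv_symm_iterate_eq_of_coeff_eq hc
    (by rw [AddSubgroupClass.coe_sub, OneMemClass.coe_one]; exact norm_natCast_lt_norm_epsC_two_sub_one)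
  have h2 := norm_untilt_frobeniusEquiv_symm_pow ((eps : PreTilt (integerC F) p) - 1) 2
  rw [h1, AddSubgroupClass.coe_sub, OneMemClass.coe_one] at h2
  -- `‖(ε-1)♯‖ = ‖ζ_{p²}-1‖^{p²}`
  have h3 := norm_epsC_sub_one_pow (F := F) (p := p) (m := 2) (by norm_num)
  rw [Nat.totient_prime_pow hp (by norm_num : 0 < 2), show 2 - 1 = 1 from rfl, pow_one] at h3
  rw [← h2, ← pow_mul, ← h3, ← pow_mul]
  congr 1
  have : 1 ≤ p := hp.one_lt.le
  zify [this]
  ring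

omit [CharZero F] in
/-- `‖(σʲ p♭)♯‖^{pʲ} = ‖p‖` (`σ = φ⁻¹` on `𝒪_{ℂ_F}♭`, `(p♭)♯ = p`). [cite: FontaineAsterisque223III, Exp. II §1.2.2] -/
theorem norm_untilt_frobeniusEquiv_symm_iterate_pFlat_pow (j : ℕ) :
    ‖((PreTilt.untilt (((frobeniusEquiv (PreTilt (integerC F) p) p).symm^[j]) pFlat) : integerC F) : CompletedAlgClosure F)‖ ^ p ^ j =
      ‖(p : CompletedAlgClosure F)‖ := by
  rw [norm_untilt_frobeniusEquiv_symm_pow, untilt_pFlat, coe_natCast_integerC]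

omit [CharZero F] in
/-- **`‖(∏_{j≤n} σʲ p♭)♯‖^{pⁿ(p−1)} = ‖p‖^{p^{n+1} − 1}`**, i.e. `v(∏_{j≤n}(p♭)^{1/pʲ}) = 1 + 1/p + ⋯ + 1/pⁿ`.
[cite: FontaineAsterisque223III, Exp. III §5.1] -/
theorem norm_untilt_prod_frobeniusEquiv_symm_iterate_pFlat_pow (n : ℕ) :
    ‖((PreTilt.untilt (∏ j ∈ range (n + 1), (((frobeniusEquiv (PreTilt (integerC F) p) p).symm^[j]) pFlat)) : integerC F) :
        CompletedAlgClosure F)‖ ^ (p ^ n * (p - 1)) = ‖(p : CompletedAlgClosure F)‖ ^ (p ^ (n + 1) - 1) := by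
  have hp := (Fact.out : p.Prime)
  have h1p : 1 ≤ p := hp.one_lt.le
  induction n with
  | zero =>
    rw [zero_add, prod_range_one, Function.iterate_zero, id, pow_zero, one_mul, untilt_pFlat, coe_natCast_integerC, pow_one]
  | succ n ih =>
    rw [prod_range_succ, map_mul, Subring.coe_mul, norm_mul, mul_pow]
    -- first factor: `(‖P_n♯‖^{pⁿ(p-1)})^p = ‖p‖^{p(p^{n+1}-1)}`
    have e1 : ‖((PreTilt.untilt (∏ j ∈ range (n + 1), (((frobeniusEquiv (PreTilt (integerC F) p) p).symm^[j]) pFlat)) :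
        integerC F) : CompletedAlgClosure F)‖ ^ (p ^ (n + 1) * (p - 1)) = ‖(p : CompletedAlgClosure F)‖ ^ (p * (p ^ (n + 1) - 1)) := by
      rw [show p ^ (n + 1) * (p - 1) = (p ^ n * (p - 1)) * p by rw [pow_succ]; ring, pow_mul, ih, ← pow_mul, mul_comm]
    -- second factor: `(‖(σⁿ⁺¹p♭)♯‖^{p^{n+1}})^{p-1} = ‖p‖^{p-1}`
    have e2 : ‖((PreTilt.untilt (((frobeniusEquiv (PreTilt (integerC F) p) p).symm^[n + 1]) pFlat) : integerC F) :
        CompletedAlgClosure F)‖ ^ (p ^ (n + 1) * (p - 1)) = ‖(p : CompletedAlgClosure F)‖ ^ (p - 1) := by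
      rw [pow_mul, norm_untilt_frobeniusEquiv_symm_iterate_pFlat_pow]
    rw [e1, e2, ← pow_add]
    congr 1
    have h2 : 1 ≤ p ^ (n + 1) := Nat.one_le_pow _ _ hp.pos
    have h3 : 1 ≤ p ^ (n + 1 + 1) := Nat.one_le_pow _ _ hp.pos
    zify [h1p, h2, h3]
    ring

/-! ### §2 Reduction modulo `p`: `constantCoeff (σʲ ξ) = σʲ(p♭)` -/

omit [CharZero F] [IsAdicComplete (Ideal.span {(p : integerC F)}) (integerC F)] in
/-- `constantCoeff` intertwines `σ = φ⁻¹` on `𝔸_inf` with the inverse Frobenius of `𝒪_{ℂ_F}♭` (reduction modulo `p` of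
`𝕎(𝒪♭)`). [cite: FontaineOuyang2022, Prop. 4.3.3] -/
theorem constantCoeff_frobeniusEquiv_symm_iterate (j : ℕ) (x : Ainf (p := p) F) :
    constantCoeff ((((WittVector.frobeniusEquiv p (PreTilt (integerC F) p)).symm : Ainf (p := p) F → Ainf (p := p) F)^[j]) x) =
      ((frobeniusEquiv (PreTilt (integerC F) p) p).symm^[j]) (constantCoeff x) := by
  induction j generalizing x with
  | zero => rfl
  | succ j ih =>
    rw [Function.iterate_succ_apply', Function.iterate_succ_apply', ← ih, WittVector.frobeniusEquiv_symm_apply,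
      constantCoeff_apply, WittVector.map_coeff, constantCoeff_apply]
    rfl

omit [CharZero F] [IsAdicComplete (Ideal.span {(p : integerC F)}) (integerC F)] in
/-- `constantCoeff (∏_{j≤n} σʲ ξ) = ∏_{j≤n} σʲ(p♭)` (`ξ ≡ p♭ mod p`). [cite: FontaineAsterisque223III, Exp. III §5.1] -/
private theorem constantCoeff_prod_frobeniusEquiv_symm_iterate_xi (n : ℕ) :
    constantCoeff (∏ j ∈ range (n + 1), ((((WittVector.frobeniusEquiv p (PreTilt (integerC F) p)).symm :
        Ainf (p := p) F → Ainf (p := p) F)^[j]) xi)) =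
      ∏ j ∈ range (n + 1), (((frobeniusEquiv (PreTilt (integerC F) p) p).symm^[j]) pFlat) := by
  rw [map_prod]
  exact prod_congr rfl fun j _ => by rw [constantCoeff_frobeniusEquiv_symm_iterate, constantCoeff_xi]

omit [IsAdicComplete (Ideal.span {(p : integerC F)}) (integerC F)] in
/-- `constantCoeff u = ε − 1`: `u = [ε] − 1 ≡ ε − 1 (mod p)`. [cite: FontaineAsterisque223III, Exp. II §1.5.4] -/
theorem constantCoeff_uAinf : constantCoeff (uAinf : Ainf (p := p) F) = eps - 1 := by
  rw [uAinf_def, map_sub, map_one, constantCoeff_apply, teichmuller_coeff_zero]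

/-! ### §3 The norm estimate `‖ā♯‖ ≤ ‖(ε − 1)♯‖` and the first digit `a = u·c₀ + p·a₁` -/

/-- A real-number lemma: if `0 ≤ s`, `0 < r`, `0 ≤ C` and `s^{M} · D ≤ C · r^{M}` for arbitrarily large `M` with a fixed `D > 0`,
then `s ≤ r`. Used with `M = pⁿ(p−1)`. [folklore] -/
private theorem le_of_forall_pow_mul_le {s r C D : ℝ} (hr : 0 < r) (hD : 0 < D)
    (h : ∀ n : ℕ, ∃ M : ℕ, n ≤ M ∧ s ^ M * D ≤ C * r ^ M) : s ≤ r := by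
  by_contra hlt
  rw [not_le] at hlt
  -- `q = s/r > 1`, `q^M ≤ C/D` for arbitrarily large `M`: contradiction with `q^M → ∞`
  have hq : 1 < s / r := (one_lt_div hr).2 hlt
  obtain ⟨n, hn⟩ := pow_unbounded_of_one_lt (C / D) hq
  obtain ⟨M, hnM, hM⟩ := h n
  have h1 : (s / r) ^ M ≤ C / D := by
    rw [div_pow, div_le_div_iff₀ (pow_pos hr M) hD]
    exact hM
  have h2 : (s / r) ^ n ≤ (s / r) ^ M := pow_le_pow_right₀ hq.le hnM
  exact absurd (h2.trans h1) (not_le.2 hn)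

/-- ★ **If `θ(φᵏ a) = 0` for all `k ≥ 0` then `‖ā♯‖ ≤ ‖(ε − 1)♯‖`** (`ā = a mod p ∈ 𝒪_{ℂ_F}♭`): for every `n`, `ā` is divisible by
`∏_{j≤n} (p♭)^{1/pʲ}` (`exists_eq_prod_mul_of_forall_fontaineTheta_frobenius_iterate_eq_zero`), so `‖ā♯‖^{pⁿ(p−1)} ≤ ‖p‖^{p^{n+1}−1}`,
while `‖(ε−1)♯‖^{pⁿ(p−1)} = ‖p‖^{p^{n+1}}`. [cite: FontaineAsterisque223III, Exp. III Prop. 5.1.3] -/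
theorem norm_untilt_constantCoeff_le_of_forall_fontaineTheta_frobenius_iterate_eq_zero {a : Ainf (p := p) F}
    (ha : ∀ k, fontaineTheta (integerC F) p ((WittVector.frobenius : Ainf (p := p) F →+* Ainf (p := p) F)^[k] a) = 0) :
    ‖((PreTilt.untilt (constantCoeff a) : integerC F) : CompletedAlgClosure F)‖ ≤
      ‖((PreTilt.untilt ((eps : PreTilt (integerC F) p) - 1) : integerC F) : CompletedAlgClosure F)‖ := by
  have hp := (Fact.out : p.Prime)
  have hp0 : 0 < ‖(p : CompletedAlgClosure F)‖ := norm_pos_iff.2 (natCast_C_ne_zero hp.ne_zero)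
  refine le_of_forall_pow_mul_le (norm_pos_iff.2 coe_untilt_eps_sub_one_ne_zero) hp0 (C := 1) fun n => ?_
  refine ⟨p ^ n * (p - 1), ?_, ?_⟩
  · calc n ≤ p ^ n := (Nat.lt_pow_self hp.one_lt).le
      _ = p ^ n * 1 := (mul_one _).symm
      _ ≤ p ^ n * (p - 1) := Nat.mul_le_mul_left _ (by have := hp.two_le; omega)
  -- `ā = (∏ σʲ p♭) · b̄`
  obtain ⟨b, hb⟩ := exists_eq_prod_mul_of_forall_fontaineTheta_frobenius_iterate_eq_zero n (fun k _ => ha k)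
  have h1 : constantCoeff a = (∏ j ∈ range (n + 1), (((frobeniusEquiv (PreTilt (integerC F) p) p).symm^[j]) pFlat)) *
      constantCoeff b := by
    rw [hb, map_mul, constantCoeff_prod_frobeniusEquiv_symm_iterate_xi]
  have h2 : ‖((PreTilt.untilt (constantCoeff a) : integerC F) : CompletedAlgClosure F)‖ ≤
      ‖((PreTilt.untilt (∏ j ∈ range (n + 1), (((frobeniusEquiv (PreTilt (integerC F) p) p).symm^[j]) pFlat)) : integerC F) :
        CompletedAlgClosure F)‖ := by
    rw [h1, map_mul, Subring.coe_mul, norm_mul]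
    exact mul_le_of_le_one_right (norm_nonneg _) (norm_coe_integerC_le _)
  have h3 := pow_le_pow_left₀ (norm_nonneg _) h2 (p ^ n * (p - 1))
  rw [norm_untilt_prod_frobeniusEquiv_symm_iterate_pFlat_pow] at h3
  -- right-hand side: `‖(ε-1)♯‖^{pⁿ(p-1)} = ‖p‖^{p^{n+1}}`
  have h4 : ‖((PreTilt.untilt ((eps : PreTilt (integerC F) p) - 1) : integerC F) : CompletedAlgClosure F)‖ ^ (p ^ n * (p - 1)) =
      ‖(p : CompletedAlgClosure F)‖ ^ p ^ (n + 1) := by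
    rw [mul_comm, pow_mul, norm_untilt_eps_sub_one_pow, ← pow_mul, ← pow_succ']
  rw [one_mul, h4]
  calc ‖((PreTilt.untilt (constantCoeff a) : integerC F) : CompletedAlgClosure F)‖ ^ (p ^ n * (p - 1)) * ‖(p : CompletedAlgClosure F)‖
      ≤ ‖(p : CompletedAlgClosure F)‖ ^ (p ^ (n + 1) - 1) * ‖(p : CompletedAlgClosure F)‖ :=
        mul_le_mul_of_nonneg_right h3 (norm_nonneg _)
    _ = ‖(p : CompletedAlgClosure F)‖ ^ p ^ (n + 1) := by
        rw [← pow_succ, Nat.sub_add_cancel (Nat.one_le_pow _ _ hp.pos)]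

/-- **First digit**: if `θ(φᵏ a) = 0` for all `k` then `a = u·c + p·a'` for some `c, a' ∈ 𝔸_inf` (`ā ∈ (ε−1)𝒪♭` by the norm estimate and
the valuation ring `𝒪_{ℂ_F}♭`; `ker(𝔸_inf → 𝒪♭) = p𝔸_inf`). [cite: FontaineAsterisque223III, Exp. III Prop. 5.1.3] -/
theorem exists_eq_uAinf_mul_add_p_mul_of_forall_fontaineTheta_frobenius_iterate_eq_zero {a : Ainf (p := p) F}
    (ha : ∀ k, fontaineTheta (integerC F) p ((WittVector.frobenius : Ainf (p := p) F →+* Ainf (p := p) F)^[k] a) = 0) :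
    ∃ c a' : Ainf (p := p) F, a = uAinf * c + (p : Ainf (p := p) F) * a' := by
  obtain ⟨c₀, hc₀⟩ := exists_eq_mul_of_norm_untilt_le coe_untilt_eps_sub_one_ne_zero
    (norm_untilt_constantCoeff_le_of_forall_fontaineTheta_frobenius_iterate_eq_zero ha)
  have h1 : constantCoeff (a - uAinf * teichmuller p c₀) = 0 := by
    rw [map_sub, map_mul, constantCoeff_uAinf, constantCoeff_apply (teichmuller p c₀), teichmuller_coeff_zero, hc₀, sub_self]
  have h2 : a - uAinf * teichmuller p c₀ ∈ Ideal.span {(p : Ainf (p := p) F)} :=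
    (WittVector.mem_span_p_iff_coeff_zero_eq_zero _).2 h1
  rw [Ideal.mem_span_singleton] at h2
  obtain ⟨a', ha'⟩ := h2
  exact ⟨teichmuller p c₀, a', by rw [← ha']; ring⟩

/-! ### §4 Induction modulo `pᴺ` and the `p`-adic limit -/

omit [Fact (¬ IsUnit (p : integerC F))] [IsAdicComplete (Ideal.span {(p : integerC F)}) (integerC F)] in
/-- `p · y = 0 ⇒ y = 0` in `𝒪_{ℂ_F}`. [folklore] -/
private theorem integerC_eq_zero_of_p_mul_eq_zero {y : integerC F} (h : (p : integerC F) * y = 0) : y = 0 := by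
  refine (mul_eq_zero.1 h).resolve_left fun h0 => natCast_C_ne_zero (F := F) (Fact.out : p.Prime).ne_zero ?_
  rw [← coe_natCast_integerC (F := F) (p := p), h0]; rfl

omit [CharZero F] [IsAdicComplete (Ideal.span {(p : integerC F)}) (integerC F)] in
/-- `φᵏ` commutes with multiplication by `pᴺ`. [folklore] -/
private theorem frobenius_iterate_natCast_pow_mul (k N : ℕ) (x : Ainf (p := p) F) :
    (WittVector.frobenius : Ainf (p := p) F →+* Ainf (p := p) F)^[k] ((p : Ainf (p := p) F) ^ N * x) =
      (p : Ainf (p := p) F) ^ N * (WittVector.frobenius : Ainf (p := p) F →+* Ainf (p := p) F)^[k] x := by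
  rw [iterate_map_mul, ← RingHom.coe_pow, map_pow, map_natCast, RingHom.coe_pow]

/-- **The step with carried hypothesis**: if `θ(φᵏ a) = 0` for all `k` then `a = u·c + p·a'` with `θ(φᵏ a') = 0` for all `k`
(`θ(φᵏ u) = 0` and `𝒪_{ℂ_F}` is `p`-torsion free). [cite: FontaineAsterisque223III, Exp. III Prop. 5.1.3] -/
theorem exists_eq_uAinf_mul_add_p_mul_and_forall {a : Ainf (p := p) F}
    (ha : ∀ k, fontaineTheta (integerC F) p ((WittVector.frobenius : Ainf (p := p) F →+* Ainf (p := p) F)^[k] a) = 0) :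
    ∃ c a' : Ainf (p := p) F, a = uAinf * c + (p : Ainf (p := p) F) * a' ∧
      ∀ k, fontaineTheta (integerC F) p ((WittVector.frobenius : Ainf (p := p) F →+* Ainf (p := p) F)^[k] a') = 0 := by
  obtain ⟨c, a', h⟩ := exists_eq_uAinf_mul_add_p_mul_of_forall_fontaineTheta_frobenius_iterate_eq_zero ha
  refine ⟨c, a', h, fun k => integerC_eq_zero_of_p_mul_eq_zero (p := p) ?_⟩
  have h1 := ha k
  rw [h, iterate_map_add, map_add, iterate_map_mul, map_mul, fontaineTheta_frobenius_iterate_uAinf (F := F) (p := p) k, zero_mul,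
    zero_add, iterate_map_mul, map_mul, ← RingHom.coe_pow, map_natCast, map_natCast] at h1
  exact h1

/-- **Approximation modulo `pᴺ`**: if `θ(φᵏ a) = 0` for all `k` then for every `N` there are `c, a'` with `a = u·c + pᴺ·a'` and
`θ(φᵏ a') = 0` for all `k`. [cite: FontaineAsterisque223III, Exp. III Prop. 5.1.3] -/
theorem exists_eq_uAinf_mul_add_pow_mul (N : ℕ) :
    ∀ {a : Ainf (p := p) F}, (∀ k, fontaineTheta (integerC F) p ((WittVector.frobenius : Ainf (p := p) F →+* Ainf (p := p) F)^[k] a) = 0) →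
      ∃ c a' : Ainf (p := p) F, a = uAinf * c + (p : Ainf (p := p) F) ^ N * a' ∧
        ∀ k, fontaineTheta (integerC F) p ((WittVector.frobenius : Ainf (p := p) F →+* Ainf (p := p) F)^[k] a') = 0 := by
  induction N with
  | zero => intro a ha; exact ⟨0, a, by rw [mul_zero, zero_add, pow_zero, one_mul], ha⟩
  | succ N ih =>
    intro a ha
    obtain ⟨c, a', h, ha'⟩ := ih ha
    obtain ⟨c', a'', h', ha''⟩ := exists_eq_uAinf_mul_add_p_mul_and_forall ha'
    exact ⟨c + (p : Ainf (p := p) F) ^ N * c', a'', by rw [h, h', pow_succ]; ring, ha''⟩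

omit [IsAdicComplete (Ideal.span {(p : integerC F)}) (integerC F)] in
/-- **`u = [ε] − 1` is a non-zero-divisor modulo every `pᴺ`**: `u·y ∈ pᴺ𝔸_inf ⇒ y ∈ pᴺ𝔸_inf` (`ε − 1 ≠ 0` in the domain `𝒪♭`, and
`𝔸_inf` is `p`-torsion free). [cite: FontaineAsterisque223III, Exp. II §1.5.4] -/
theorem mem_span_pow_of_uAinf_mul_mem (N : ℕ) :
    ∀ {y : Ainf (p := p) F}, uAinf * y ∈ Ideal.span {(p : Ainf (p := p) F) ^ N} → y ∈ Ideal.span {(p : Ainf (p := p) F) ^ N} := by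
  induction N with
  | zero => intro y _; rw [pow_zero, Ideal.span_singleton_one]; exact Submodule.mem_top
  | succ N ih =>
    intro y hy
    -- mod `p`: `(ε - 1) ȳ = 0` in the domain `𝒪♭`
    have h1 : uAinf * y ∈ Ideal.span {(p : Ainf (p := p) F)} :=
      Ideal.span_singleton_le_span_singleton.2 (dvd_pow_self _ (Nat.succ_ne_zero N)) hy
    rw [WittVector.mem_span_p_iff_coeff_zero_eq_zero, ← constantCoeff_apply, map_mul, constantCoeff_uAinf] at h1
    have h2 : constantCoeff y = 0 := (mul_eq_zero.1 h1).resolve_left eps_sub_one_ne_zero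
    have h3 : y ∈ Ideal.span {(p : Ainf (p := p) F)} := (WittVector.mem_span_p_iff_coeff_zero_eq_zero _).2 h2
    rw [Ideal.mem_span_singleton] at h3
    obtain ⟨y', rfl⟩ := h3
    -- `p (u y') ∈ p^{N+1}` ⇒ `u y' ∈ p^N`
    rw [Ideal.mem_span_singleton] at hy ⊢
    obtain ⟨z, hz⟩ := hy
    have h4 : uAinf * y' = (p : Ainf (p := p) F) ^ N * z := by
      have e : ((p : Ainf (p := p) F)) * (uAinf * y' - (p : Ainf (p := p) F) ^ N * z) = 0 := by
        linear_combination hz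
      have e2 := WittVector.eq_zero_of_p_mul_eq_zero (uAinf * y' - (p : Ainf (p := p) F) ^ N * z) (by rw [mul_comm]; exact e)
      exact sub_eq_zero.1 e2
    have h5 : y' ∈ Ideal.span {(p : Ainf (p := p) F) ^ N} := ih (by rw [Ideal.mem_span_singleton]; exact ⟨z, h4⟩)
    rw [Ideal.mem_span_singleton] at h5
    obtain ⟨w, rfl⟩ := h5
    exact ⟨w, by rw [pow_succ]; ring⟩

/-- ★★ **Fontaine's `𝔸_inf`-lemma, `⊇`: if `θ(φᵏ a) = 0` for all `k ≥ 0` then `([ε] − 1) ∣ a`.** From `a = u c_N + pᴺ a_N` for all `N`: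
`u (c_{N+1} − c_N) ∈ pᴺ𝔸_inf`, so `(c_N)` is `p`-adically Cauchy (`u` regular mod `pᴺ`), converges to some `c` (`𝔸_inf` is
`p`-adically complete), and `a − u c ∈ ⋂_N pᴺ𝔸_inf = 0`. [cite: FontaineAsterisque223III, Exp. III Prop. 5.1.3]
[cite: FontaineOuyang2022, Prop. 4.3.3] -/
theorem uAinf_dvd_of_forall_fontaineTheta_frobenius_iterate_eq_zero {a : Ainf (p := p) F}
    (ha : ∀ k, fontaineTheta (integerC F) p ((WittVector.frobenius : Ainf (p := p) F →+* Ainf (p := p) F)^[k] a) = 0) :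
    uAinf ∣ a := by
  choose c a' hca' _ using fun N => exists_eq_uAinf_mul_add_pow_mul (F := F) (p := p) N ha
  -- `c` is `p`-adically Cauchy
  have hc : ∀ N, c (N + 1) - c N ∈ Ideal.span {(p : Ainf (p := p) F) ^ N} := by
    intro N
    refine mem_span_pow_of_uAinf_mul_mem N ?_
    rw [Ideal.mem_span_singleton]
    refine ⟨a' N - (p : Ainf (p := p) F) * a' (N + 1), ?_⟩
    have h1 := hca' N
    have h2 := hca' (N + 1)
    rw [pow_succ] at h2
    linear_combination h1 - h2
  obtain ⟨L, hL⟩ := GaloisContinuity.exists_padic_lim_ainf hc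
  -- `a - u L ∈ p^N` for all `N`
  have hmem : ∀ N, a - uAinf * L ∈ Ideal.span {(p : Ainf (p := p) F) ^ N} := by
    intro N
    have e : a - uAinf * L = (p : Ainf (p := p) F) ^ N * a' N - uAinf * (L - c N) := by
      have h1 := hca' N; linear_combination h1
    rw [e]
    refine sub_mem ?_ (Ideal.mul_mem_left _ _ (hL N))
    exact Ideal.mul_mem_right _ _ (Ideal.mem_span_singleton_self _)
  have hzero : a - uAinf * L = 0 := by
    refine IsHausdorff.haus' (I := Ideal.span {(p : Ainf (p := p) F)}) _ fun N => ?_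
    rw [smul_eq_mul, Ideal.mul_top, Ideal.span_singleton_pow, SModEq.zero]
    exact hmem N
  exact ⟨L, (sub_eq_zero.1 hzero)⟩

/-- ★★ **Fontaine's `𝔸_inf`-lemma `I^{[1]}𝔸_inf = ([ε] − 1)·𝔸_inf`**: `([ε] − 1) ∣ a` iff `θ(φᵏ a) = 0` for every `k ≥ 0`.
[cite: FontaineAsterisque223III, Exp. III Prop. 5.1.3] [cite: FontaineOuyang2022, Prop. 4.3.3] -/
theorem uAinf_dvd_iff_forall_fontaineTheta_frobenius_iterate_eq_zero (a : Ainf (p := p) F) :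
    uAinf ∣ a ↔ ∀ k, fontaineTheta (integerC F) p ((WittVector.frobenius : Ainf (p := p) F →+* Ainf (p := p) F)^[k] a) = 0 := by
  refine ⟨fun ⟨b, hb⟩ k => ?_, uAinf_dvd_of_forall_fontaineTheta_frobenius_iterate_eq_zero⟩
  rw [hb, iterate_map_mul, map_mul, fontaineTheta_frobenius_iterate_uAinf (F := F) (p := p) k, zero_mul]

end Literature.NumberTheory.PAdicHodge

end
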